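import Summits.FinalStateConjecture.FinalStateConjecture.Theorems.PhotonSphereChannelsDarkFutureDefs
import Summits.FinalStateConjecture.FinalStateConjecture.Theorems.PhotonSphereChannelsChannelsResolveTameDevelopmentsRKerrDocOrientation
import Summits.FinalStateConjecture.FinalStateConjecture.Theorems.PhotonSphereChannelsChannelsResolveTameDevelopmentsRKerrDocOfLocalIsometry
import Summits.FinalStateConjecture.FinalStateConjecture.Theorems.PhotonSphereChannelsChannelsResolveTameDevelopmentsRHorizonHullBlackHole
import Summits.FinalStateConjecture.FinalStateConjecture.Theorems.PhotonSphereChannelsChannelsResolveTameDevelopmentsRNonRadiatingAllOrders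
import Summits.FinalStateConjecture.FinalStateConjecture.Theorems.PhotonSphereChannelsChannelsResolveTameDevelopmentsRFarDeviationSmooth
import Literature.Geometry.Lorentzian.KerrConvergenceProofs
import Literature.Geometry.Lorentzian.Isometry
import Literature.Geometry.Lorentzian.KerrDataProofs
import Literature.Geometry.Lorentzian.KerrSchildCoord
import HarnessLib

/-!
# Route PhotonSphereChannels · crux `ChannelsResolveTameDevelopmentsR` (K2R-T2, stmt-FinalStateConjecture-17430) ·
# line `tame-lasalle-dock` · stub R `stub_hullRigidGivenSEK`: the END-LEVEL TRANSFER of the docked rigidity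
# (SEK ⇒ classification of a silent tame eternal end), with its side conditions explicit

The line `tame-lasalle-dock` (`Cruxes/ChannelsResolveTameDevelopmentsR/Lines/tame_lasalle_dock.lean`) docks the
rigidity core of the crux onto route EternalPapapetrou's items L (stmt-10034) and U (stmt-10745), whose composite
SEK — "a Ricci-flat globally hyperbolic spacetime with an eternal far chart that is `(1/r)`-close to
Schwarzschild at every order and two-sided non-radiating at every order, and which is a black-hole spacetime
w.r.t. the far end or timelike+null complete, has d.o.c. isometric to a Kerr exterior `0 < M'`, `|a| ≤ M'`, or
is globally isometric to Minkowski space" — is proved from the two docks in the skeleton. Stub R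
(`HullRigidGivenSEK`) transfers SEK to the hull elements of a tame development. This file proves the transfer
AT THE LEVEL OF ONE END, with every side condition an explicit hypothesis, so that what R still owes is
visible in the signatures:

* §1 `isIsometry_symm` — the inverse of an isometry is an isometry (O'Neill 1983, Ch. 3, p. 58);
  `isMinkowski_of_isIsometry` — **U's Minkowski disjunct ⇒ `TameHull.IsMinkowski`**: a spacetime globally
  isometric to `(ℝ⁴, η)` carries a smooth bijection `E4 → 𝓢` with `Ψ^* g − η = 0` and `Ψ_* ∂₀` future-directed
  (invert the isometry; the orientation functional `g(T, Ψ_* ∂₀)` is continuous and non-vanishing on the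
  connected `E4`, and in the past case `Ψ ∘ (−id)` is again an exact chart with `∂₀` reversed).
* §2 `isMinkowski_or_exists_isKerrDoc_of_silentEternalIsKerr` — **the transfer for one end**: SEK (as an
  explicit hypothesis, the skeleton's `SilentEternalIsKerr` verbatim) + an end `E` of `𝓢` in an all-orders
  class `IsTameClass E Λ r₀` which is silent (`E.IsSilent`) + the three SIDE CONDITIONS (global
  hyperbolicity of `𝓢`; black-hole-w.r.t.-the-end or timelike+null complete; every Kerr exterior isometric to
  `E.doc` up to orientation is sub-extremal) ⇒ `IsMinkowski 𝓢 ∨ ∃ M a, 0 < M ∧ |a| < M ∧ IsKerrDoc 𝓢 E.doc M a`.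
  The far data are read off the class (`E.B/E.h/E.hdot` are SEK's `B/h/hₜ` definitionally; all-orders bounds
  `IsTameClass.order`; all-orders non-radiation `DarkFuture.isNonRadiating_allOrders`, G1; smooth far
  deviation `DarkFuture.contDiffAt_farDeviation_of_isTameEnd`, G0), the Kerr branch is oriented by
  `DarkFuture.orientationFix_of_subextremal` (G4b) and turned into `IsKerrDoc` by
  `DarkFuture.isKerrDoc_of_isLocalIsometry` (G4), the Minkowski branch is §1.
* §3 the two hull-element forms R needs: `exists_isKerrDoc_of_isHorizonHullElementAlong_of_SEK` (R2-shape: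
  the black-hole disjunct is automatic, `DarkFuture.blackHoleRegion_nonempty_of_isHorizonHullElementAlong`, G3;
  a horizon-hull element is never Minkowski — hypothesis `¬ IsMinkowski 𝓢`, dischargeable by the landed
  Kretschmann lemmas `DarkFuture.not_isMinkowski_of_isHorizonHullElement_of_le` when the curvature along the
  generator is pinned away from `0`) and `isMinkowski_or_exists_isKerrDoc_of_isSilentHullElement_of_SEK`
  (R1-shape; outer elements with NONEMPTY horizon are black-hole spacetimes w.r.t. their end,
  `DarkFuture.blackHoleRegion_nonempty_of_mem_horizon`, so only HORIZONLESS outer elements owe the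
  black-hole-or-complete disjunct); and `hullRigidGivenSEK_of_sideConditions` — R's registered text VERBATIM
  from SEK and the side conditions asked of every element.

What R still owes after this file (the honest residue, each a statement about hull elements of a `DevHyp`
development, not about bare ends): (G2) a globally hyperbolic representative of each hull element with the same
d.o.c. (hull elements carry no covering clause — `Spacetime.SubconvergesLocallyTo.restrict'` — so an element
trimmed inside its black-hole region is again an element and is not globally hyperbolic; the transfer back is
the landed `DarkFuture.isKerrDoc_of_isLocalIsometry_image`, T1); (G5) the extremal shadow `|a| = M'` excluded
((i) `NoExtremalRemnant` in ω-limit form); (G6) flat ends have empty horizon / horizonless outer elements are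
black-hole-or-complete. Nothing here restates a route item: SEK enters only as a hypothesis, R's text only as a
conclusion.

References: O'Neill 1983, Ch. 3, Def. 3.4 and p. 58, Ch. 5, Lemma 5.26 ff. [ONeill1983]; Hawking–Ellis 1973,
§3.1, §5.1 [HawkingEllis1973]; Christodoulou–Klainerman 1993, Thm. 1.0.2 [ChristodoulouKlainerman1993];
Wald 1984, §12.1 [Wald1984]; Dafermos–Luk 2017, Conjecture 1 [DafermosLuk2017]; Alexakis–Ionescu–Klainerman
2010, Thm. 1.1 [AlexakisIonescuKlainerman2009].
-/

noncomputable section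

-- the operator-norm instance on `E4 →L[ℝ] E4 →L[ℝ] ℝ` needs one more level of pending
-- instance problems than the default (as in `PhotonSphereChannelsTameHullDefs.lean`)
set_option maxSynthPendingDepth 3
-- every `Summit.FinalStateConjecture.FinalStateConjecture.…` name repeats the summit = sub-problem segment (D-0017 layout)
set_option linter.dupNamespace false

open Set Filter Function TopologicalSpace Manifold Bundle
open scoped Topology Manifold ContDiff ENNReal NNReal

namespace Summit.FinalStateConjecture.FinalStateConjecture.Theorems.TameLaSalle

open Literature.Geometry.Lorentzian
open Summit.FinalStateConjecture.FinalStateConjecture.Theorems.TameHull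
open Summit.FinalStateConjecture.FinalStateConjecture.Theorems.DarkFuture

/-! ### §1 Inverting an isometry; U's Minkowski disjunct gives `IsMinkowski` -/

section IsometrySymm

variable {EM EN HM HN : Type*} [NormedAddCommGroup EM] [NormedSpace ℝ EM]
  [NormedAddCommGroup EN] [NormedSpace ℝ EN] [TopologicalSpace HM] [TopologicalSpace HN]
  {IM : ModelWithCorners ℝ EM HM} {IN : ModelWithCorners ℝ EN HN}
  {XM XN : Type*} [TopologicalSpace XM] [ChartedSpace HM XM] [TopologicalSpace XN]
  [ChartedSpace HN XN] [IsManifold IM ∞ XM] [IsManifold IN ∞ XN] {n m : ℕ∞ω}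
  {gN : PseudoRiemannianMetric IN n EN (TangentSpace IN : XN → Type _)}
  {gM : PseudoRiemannianMetric IM n EM (TangentSpace IM : XM → Type _)}

/-- **The inverse of an isometry is an isometry**: if `Φ : N ≅ M` (class `C^m`, `m ≠ 0`) satisfies
`Φ^* g_M = g_N`, then `(Φ⁻¹)^* g_N = (Φ⁻¹)^* Φ^* g_M = (Φ ∘ Φ⁻¹)^* g_M = g_M` (chain rule for pullbacks,
`pullbackBilin_comp`). O'Neill 1983, Ch. 3, Def. 3.4 and p. 58. [cite: ONeill1983, Ch. 3, Def. 3.4 (p. 58)] -/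
theorem isIsometry_symm {Φ : Diffeomorph IN IM XN XM m} (hm : m ≠ 0)
    (hΦ : PseudoRiemannianMetric.IsIsometry gN gM Φ) :
    PseudoRiemannianMetric.IsIsometry gM gN Φ.symm := by
  intro x
  have hgN : gN.val = pullbackBilin (I := IM) (I' := IN) Φ gM.val := (funext hΦ).symm
  rw [hgN, ← pullbackBilin_comp (Φ.contMDiff.mdifferentiable hm) (Φ.symm.contMDiff.mdifferentiable hm)]
  have hid : ((Φ : XN → XM) ∘ (Φ.symm : XM → XN)) = id := funext Φ.apply_symm_apply
  rw [hid, pullbackBilin_id]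

end IsometrySymm

/-- **Continuity of the orientation functional for a chart on all of `E4`**: for a smooth
`Φ : E4 → 𝓢` and a constant vector `v`, `x ↦ g_{Φ x}(T(Φ x), dΦ_x v)` is continuous — the `Opens`
version `DarkFuture.continuous_val_vectorField_mfderiv_const` on `⊤ ⊆ E4`, with `d(Φ ∘ ι)_x = dΦ_{↑x}`
(`mfderiv_comp_subtypeVal'`). O'Neill 1983, Ch. 3, Def. 3.1. [cite: ONeill1983, Ch. 3, Def. 3.1] -/
theorem continuous_val_vectorField_mfderiv_const_E4 {𝓢 : Spacetime.{0} 4} {Φ : E4 → 𝓢.carrier}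
    (hΦ : ContMDiff 𝓘(ℝ, E4) (𝓡 4) ∞ Φ) (v : E4) :
    Continuous fun x : E4 ↦ 𝓢.metric.val (Φ x) (𝓢.timeOrientation.vectorField (Φ x))
      (mfderiv 𝓘(ℝ, E4) (𝓡 4) Φ x v) := by
  set U : Opens E4 := ⊤
  have hΦU : ContMDiff 𝓘(ℝ, E4) (𝓡 4) ∞ (Φ ∘ Subtype.val : U → 𝓢.carrier) :=
    hΦ.comp contMDiff_subtype_val
  have hc := continuous_val_vectorField_mfderiv_const (U := U) hΦU v
  -- descend from `U = ⊤` to `E4` along the homeomorphism `x ↦ ⟨x, trivial⟩`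
  have hmk : Continuous fun x : E4 ↦ (⟨x, trivial⟩ : U) := continuous_id.subtype_mk _
  convert hc.comp hmk using 1
  funext x
  simp only [Function.comp_apply]
  rw [mfderiv_comp_subtypeVal']
  rfl

/-- **U's Minkowski disjunct gives `TameHull.IsMinkowski`.** If `𝓢` is globally isometric to Minkowski space
(a `C^∞` diffeomorphism `Ψ : 𝓢 ≅ E4` with `Ψ^* η = g` — the second disjunct of route EternalPapapetrou's
`EternalStationaryExteriorIsKerr`), then `𝓢` is Minkowski in the sense of `TameHull.IsMinkowski`: `Φ = Ψ⁻¹`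
is a smooth bijection with `Φ^* g = η` (`isIsometry_symm`), `Φ_* ∂₀` is timelike everywhere, the orientation
functional `x ↦ g(T(Φ x), Φ_* ∂₀)` is continuous and non-vanishing on the connected `E4`, hence of one sign;
if it is positive (past case) replace `Φ` by `Φ ∘ (−id)`, again a smooth bijection with `(Φ ∘ (−id))^* g = η`
and `d(Φ ∘ (−id)) ∂₀ = −Φ_* ∂₀`. O'Neill 1983, Ch. 5, Lemma 5.26 ff. (p. 145); Hawking–Ellis 1973, §5.1.
[cite: ONeill1983, Ch. 5, Lemma 5.26] -/
theorem isMinkowski_of_isIsometry {𝓢 : Spacetime.{0} 4}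
    (Ψ : Diffeomorph (𝓡 4) 𝓘(ℝ, E4) 𝓢.carrier E4 (⊤ : ℕ∞))
    (hΨ : PseudoRiemannianMetric.IsIsometry 𝓢.metric.toPseudoRiemannianMetric
      (Minkowski.metric.ofLE le_top : LorentzianMetric 𝓘(ℝ, E4) (⊤ : ℕ∞) E4).toPseudoRiemannianMetric Ψ) :
    IsMinkowski 𝓢 := by
  have htop : (((⊤ : ℕ∞) : ℕ∞ω)) ≠ 0 := by simp
  set Φ : E4 → 𝓢.carrier := fun x ↦ Ψ.symm x with hΦ_def
  have hΦiso := isIsometry_symm (gN := 𝓢.metric.toPseudoRiemannianMetric)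
    (gM := (Minkowski.metric.ofLE le_top :
      LorentzianMetric 𝓘(ℝ, E4) (⊤ : ℕ∞) E4).toPseudoRiemannianMetric) htop hΨ
  have hΦsm : ContMDiff 𝓘(ℝ, E4) (𝓡 4) ∞ Φ := Ψ.symm.contMDiff
  have hΦmd : MDifferentiable 𝓘(ℝ, E4) (𝓡 4) Φ := hΦsm.mdifferentiable (by simp)
  have hΦbij : Function.Bijective Φ := Ψ.symm.toEquiv.bijective
  -- the isometry identity, fibrewise: `g(dΦ v, dΦ w) = η(v, w)`
  have hgram : ∀ (x : E4) (v w : E4),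
      𝓢.metric.val (Φ x) (mfderiv 𝓘(ℝ, E4) (𝓡 4) Φ x v) (mfderiv 𝓘(ℝ, E4) (𝓡 4) Φ x w) =
        Minkowski.bilin v w := fun x v w ↦
    DFunLike.congr_fun (DFunLike.congr_fun (hΦiso x) v) w
  have hdev : ∀ x, 𝓢.minkowskiDeviation Φ x = 0 := fun x ↦ by
    ext v w
    rw [Spacetime.minkowskiDeviation_apply, hgram, sub_self]
    rfl
  -- `Φ_* ∂₀` is timelike
  have htl : ∀ x : E4, 𝓢.metric.IsTimelike (mfderiv 𝓘(ℝ, E4) (𝓡 4) Φ x (E4.basisVector 0)) := fun x ↦ by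
    rw [LorentzianMetric.isTimelike_iff, hgram]
    exact Minkowski.bilin_basisVector_zero.trans_lt neg_one_lt_zero
  -- the orientation functional
  set f : E4 → ℝ := fun x ↦ 𝓢.metric.val (Φ x) (𝓢.timeOrientation.vectorField (Φ x))
    (mfderiv 𝓘(ℝ, E4) (𝓡 4) Φ x (E4.basisVector 0)) with hf_def
  have hf_cont : Continuous f := continuous_val_vectorField_mfderiv_const_E4 hΦsm (E4.basisVector 0)
  have hf_ne : ∀ x, f x ≠ 0 := fun x ↦
    𝓢.metric.val_ne_zero_of_isTimelike_of_isCausal (𝓢.timeOrientation.isTimelike (Φ x)) (htl x).isCausal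
  by_cases hpast : ∃ x₀ : E4, 0 < f x₀
  · -- past case: `f > 0` everywhere on the connected `E4`; use `Φ ∘ (−id)`
    obtain ⟨x₀, hfx₀⟩ := hpast
    have hpos : ∀ x, 0 < f x := fun x ↦
      pos_of_isPreconnected_of_ne_zero isPreconnected_univ hf_cont.continuousOn
        (fun p _ ↦ hf_ne p) (mem_univ x₀) hfx₀ (mem_univ x)
    have hνsm : ContMDiff 𝓘(ℝ, E4) 𝓘(ℝ, E4) ∞ (fun y : E4 ↦ -y) := contDiff_neg.contMDiff
    have hνmd : MDifferentiable 𝓘(ℝ, E4) 𝓘(ℝ, E4) (fun y : E4 ↦ -y) := hνsm.mdifferentiable (by simp)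
    have hνd : ∀ x : E4, mfderiv 𝓘(ℝ, E4) 𝓘(ℝ, E4) (fun y : E4 ↦ -y) x =
        -ContinuousLinearMap.id ℝ E4 := fun x ↦ by
      have h : (fun y : E4 ↦ -y) = -id := rfl
      rw [h, mfderiv_neg, mfderiv_id]
      rfl
    -- chain rule: `d(Φ ∘ (−id))_x v = −dΦ_{−x} v`
    have hcomp : ∀ x v : E4, mfderiv 𝓘(ℝ, E4) (𝓡 4) (Φ ∘ fun y : E4 ↦ -y) x v =
        -(mfderiv 𝓘(ℝ, E4) (𝓡 4) Φ (-x) v) := fun x v ↦ by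
      have h2 : mfderiv 𝓘(ℝ, E4) 𝓘(ℝ, E4) (fun y : E4 ↦ -y) x v = -v := by
        rw [hνd]
        rfl
      rw [mfderiv_comp x (hΦmd _) (hνmd x)]
      change mfderiv 𝓘(ℝ, E4) (𝓡 4) Φ (-x) (mfderiv 𝓘(ℝ, E4) 𝓘(ℝ, E4) (fun y : E4 ↦ -y) x v) = _
      exact (congrArg (mfderiv 𝓘(ℝ, E4) (𝓡 4) Φ (-x)) h2).trans (map_neg _ v)
    have hνinv : Function.Involutive (fun y : E4 ↦ -y) := fun x ↦ neg_neg x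
    refine ⟨Φ ∘ fun y : E4 ↦ -y, hΦbij.comp hνinv.bijective, hΦsm.comp hνsm, fun x ↦ ?_, fun x ↦ ?_⟩
    · ext v w
      have h1 := hgram (-x) v w
      have h3 : 𝓢.metric.val (Φ (-x)) (-(mfderiv 𝓘(ℝ, E4) (𝓡 4) Φ (-x) v))
          (-(mfderiv 𝓘(ℝ, E4) (𝓡 4) Φ (-x) w)) = Minkowski.bilin v w := by
        rw [map_neg, map_neg, neg_apply, neg_neg, h1]
      rw [Spacetime.minkowskiDeviation_apply, hcomp, hcomp]
      show 𝓢.metric.val (Φ (-x)) (-(mfderiv 𝓘(ℝ, E4) (𝓡 4) Φ (-x) v))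
          (-(mfderiv 𝓘(ℝ, E4) (𝓡 4) Φ (-x) w)) - Minkowski.bilin v w = 0
      rw [h3, sub_self]
    · have h4 := (𝓢.timeOrientation.isFutureDirected_neg_iff _).2 ⟨(htl (-x)).isCausal, hpos (-x)⟩
      have h5 := hcomp x (E4.basisVector 0)
      show 𝓢.timeOrientation.IsFutureDirected (mfderiv 𝓘(ℝ, E4) (𝓡 4) (Φ ∘ fun y : E4 ↦ -y) x (E4.basisVector 0))
      rw [h5]
      exact h4
  · -- `Φ_* ∂₀` is already future-directed
    have hneg : ∀ x, f x < 0 := fun x ↦ lt_of_le_of_ne (not_lt.1 fun h' ↦ hpast ⟨x, h'⟩) (hf_ne x)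
    exact ⟨Φ, hΦbij, hΦsm, hdev, fun x ↦ ⟨(htl x).isCausal, hneg x⟩⟩

/-! ### §2 The transfer for ONE silent tame eternal end -/

/-- **The END-level transfer (stub R of line `tame-lasalle-dock`, items (1), (3), (4) of its docstring).**
Hypotheses: SEK verbatim (the skeleton's `SilentEternalIsKerr`: silent eternal vacua are Kerr or Minkowski,
all-orders form — in the line it is PROVED from the docked items stmt-10034 and stmt-10745); an end `E` of `𝓢`
in the all-orders class `IsTameClass E Λ r₀` which is silent; and the three SIDE CONDITIONS — (G2) `𝓢` is
globally hyperbolic, (G3/G6) `𝓢` is a black-hole spacetime w.r.t. the far end or timelike- and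
null-geodesically complete, (G5) every Kerr exterior locally isometric onto `E.doc` (up to time orientation)
is SUB-extremal. Conclusion: `𝓢` is Minkowski (`TameHull.IsMinkowski`) or `E.doc` is EXACTLY a sub-extremal
Kerr exterior (`TameHull.IsKerrDoc`). Proof: the far data of `E` are SEK's — `E.B/E.h/E.hdot` are its
`B/h/hₜ` definitionally, `0 ≤ E.M`, `max (2M) 0 < E.R`, vacuum, injective local-diffeomorphic far chart are
fields of `IsTameEnd`, the all-orders bounds are `IsTameClass.order` with `C m := Λ m`, all-orders two-sided
non-radiation is `isNonRadiating_allOrders` (G1) fed by `contDiffAt_farDeviation_of_isTameEnd` (G0); SEK's Kerr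
branch is made sub-extremal by (G5), future-oriented by `orientationFix_of_subextremal` (G4b) and exact by
`isKerrDoc_of_isLocalIsometry` (G4); its Minkowski branch is `isMinkowski_of_isIsometry` (§1).
[cite: DafermosLuk2017, Conjecture 1] [cite: AlexakisIonescuKlainerman2009, Thm 1.1] -/
theorem isMinkowski_or_exists_isKerrDoc_of_silentEternalIsKerr [Kerr.Facts]
    (hSEK : ∀ (M R : ℝ) (C : ℕ → ℝ), 0 ≤ M → max (2 * M) 0 < R → ∀ (𝓢 : Literature.Geometry.Lorentzian.Spacetime.{0} 4) [𝓢.metric.toPseudoRiemannianMetric.HasLeviCivita] [Literature.Geometry.Lorentzian.Kerr.Facts], 𝓢.metric.toPseudoRiemannianMetric.IsRicciFlat → 𝓢.metric.IsGloballyHyperbolic 𝓢.timeOrientation → ∀ (Φ : Literature.Geometry.Lorentzian.Kerr.region (0 : ℝ) R → 𝓢.carrier), IsLocalDiffeomorph 𝓘(ℝ, Literature.Geometry.Lorentzian.E4) (𝓡 4) (⊤ : ℕ∞) Φ → Function.Injective Φ → let B : Literature.Geometry.Lorentzian.ModelBackground := ⟨Literature.Geometry.Lorentzian.Kerr.region 0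 R, Literature.Geometry.Lorentzian.Kerr.bilin M 0, fun x ↦ x 0, Literature.Geometry.Lorentzian.Kerr.radius 0⟩; let h : Literature.Geometry.Lorentzian.E4 → Literature.Geometry.Lorentzian.E4 →L[ℝ] Literature.Geometry.Lorentzian.E4 →L[ℝ] ℝ := 𝓢.deviationExtend B Φ; let hₜ : Literature.Geometry.Lorentzian.E4 → Literature.Geometry.Lorentzian.E4 →L[ℝ] Literature.Geometry.Lorentzian.E4 →L[ℝ] ℝ := fun y ↦ fderiv ℝ h y (Literature.Geometry.Lorentzian.E4.basisVector 0); (∀ (m : ℕ) (x : Literature.Geometry.Lorentzian.Kerr.region (0 : ℝ) R), ‖iteratedFDeriv ℝ m h x.1‖ * Literature.Geometry.Lorentzian.Kerr.radius 0 x.1 ≤ C m) → (∀ (m : ℕ), ∀ δ > (0 : ℝ), ∃ R' : ℝ, ∀ x : Literature.Geometry.Lorentzian.Kerr.region (0 : ℝ) R, R' < Literature.Geometry.Lorentzian.Kerr.radius 0 x.1 → ‖iteratedFDeriv ℝ m hₜ x.1‖ * Literature.Geometry.Lorentzian.Kerr.radius 0 x.1 ≤ δ) → ((𝓢.blackHoleRegionOfEnd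 (Set.range Φ)).Nonempty ∨ (𝓢.metric.IsTimelikeGeodesicallyComplete ∧ 𝓢.metric.IsNullGeodesicallyComplete)) → (∃ (M' a : ℝ), 0 < M' ∧ |a| ≤ M' ∧ ∃ Ψ : Literature.Geometry.Lorentzian.Kerr.exterior M' a → 𝓢.carrier, Function.Injective Ψ ∧ Set.range Ψ = 𝓢.docOfEnd (Set.range Φ) ∧ Literature.Geometry.Lorentzian.PseudoRiemannianMetric.IsLocalIsometry (Literature.Geometry.Lorentzian.Kerr.smoothMetric M' a (Literature.Geometry.Lorentzian.Kerr.rPlus M' a)).toPseudoRiemannianMetric 𝓢.metric.toPseudoRiemannianMetric Ψ) ∨ (∃ Ψ : Diffeomorph (𝓡 4) 𝓘(ℝ, Literature.Geometry.Lorentzian.E4) 𝓢.carrier Literature.Geometry.Lorentzian.E4 (⊤ : ℕ∞), Literature.Geometry.Lorentzian.PseudoRiemannianMetric.IsIsometry 𝓢.metric.toPseudoRiemannianMetric (Literature.Geometry.Lorentzian.Minkowski.metric.ofLE le_top : Literature.Geometry.Lorentzian.LorentzianMetric 𝓘(ℝ, Literature.Geometry.Lorentzian.E4) (⊤ : ℕ∞)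 Literature.Geometry.Lorentzian.E4).toPseudoRiemannianMetric Ψ))
    {𝓢 : Spacetime.{0} 4} [𝓢.metric.HasLeviCivita] (E : EndDatum 𝓢) {Λ : ℕ → ℝ≥0} {r₀ : ℝ}
    (hcls : IsTameClass E Λ r₀) (hsil : E.IsSilent)
    (hGH : 𝓢.metric.IsGloballyHyperbolic 𝓢.timeOrientation)
    (hbh : (𝓢.blackHoleRegionOfEnd (Set.range E.far)).Nonempty ∨
      (𝓢.metric.IsTimelikeGeodesicallyComplete ∧ 𝓢.metric.IsNullGeodesicallyComplete))
    (hsub : ∀ M' a : ℝ, 0 < M' → |a| ≤ M' →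
      (∃ Ψ : Kerr.exterior M' a → 𝓢.carrier, Function.Injective Ψ ∧ Set.range Ψ = E.doc ∧
        PseudoRiemannianMetric.IsLocalIsometry
          (Kerr.smoothMetric M' a (Kerr.rPlus M' a)).toPseudoRiemannianMetric
          𝓢.metric.toPseudoRiemannianMetric Ψ) → |a| < M') :
    IsMinkowski 𝓢 ∨ ∃ M a : ℝ, 0 < M ∧ |a| < M ∧ IsKerrDoc 𝓢 E.doc M a := by
  have htame : E.IsTameEnd (Λ 3) r₀ := hcls.isTameEnd
  have hsmooth : ∀ x : Kerr.region (0 : ℝ) E.R, ContDiffAt ℝ ∞ E.h x.1 :=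
    contDiffAt_farDeviation_of_isTameEnd E (Λ 3) r₀ htame
  -- the far data of `E` in the shape of SEK
  have hM : 0 ≤ E.M := htame.mass_nonneg
  have hR : max (2 * E.M) 0 < E.R := htame.lt_R
  have hRpos : 0 < E.R := lt_of_le_of_lt (le_max_right _ _) hR
  have hvac : 𝓢.metric.toPseudoRiemannianMetric.IsRicciFlat := htame.vacuum
  have hfar_bound : ∀ k : ℕ, ∀ m ≤ k, ∀ x : Kerr.region (0 : ℝ) E.R,
      ‖iteratedFDeriv ℝ m E.h x.1‖ * Kerr.radius 0 x.1 ≤ Λ k := fun k ↦ (hcls.order k).far_bound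
  have hbd : ∀ (m : ℕ) (x : Kerr.region (0 : ℝ) E.R),
      ‖iteratedFDeriv ℝ m E.h x.1‖ * Kerr.radius 0 x.1 ≤ (fun m : ℕ ↦ ((Λ m : ℝ≥0) : ℝ)) m :=
    fun m x ↦ hfar_bound m m le_rfl x
  have hnonrad : ∀ m : ℕ, ∀ δ > (0 : ℝ), ∃ R' : ℝ, ∀ x : Kerr.region (0 : ℝ) E.R,
      R' < Kerr.radius 0 x.1 → ‖iteratedFDeriv ℝ m E.hdot x.1‖ * Kerr.radius 0 x.1 ≤ δ :=
    isNonRadiating_allOrders E Λ hRpos hsmooth hfar_bound hsil.1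
  -- SEK: the d.o.c. is a Kerr exterior up to orientation, or the spacetime is Minkowski
  have hdich := hSEK E.M E.R (fun m : ℕ ↦ ((Λ m : ℝ≥0) : ℝ)) hM hR 𝓢 hvac hGH E.far
    htame.far_isLocalDiffeomorph htame.far_injective hbd hnonrad hbh
  rcases hdich with ⟨M', a, hM', ha, Ψ, hinj, hrange, hiso⟩ | ⟨Ψ, hΨ⟩
  · -- Kerr branch: sub-extremal by (G5), future-oriented by the orientation fix, exact by G4
    have ha' : |a| < M' := hsub M' a hM' ha ⟨Ψ, hinj, hrange, hiso⟩
    obtain ⟨Ψ', hinj', hrange', hiso', hfut'⟩ :=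
      orientationFix_of_subextremal E.doc M' a hM' ha' ⟨Ψ, hinj, hrange, hiso⟩
    exact Or.inr ⟨M', a, hM', ha', isKerrDoc_of_isLocalIsometry E.doc M' a Ψ' hinj' hrange' hiso' hfut'⟩
  · -- Minkowski branch
    exact Or.inl (isMinkowski_of_isIsometry Ψ hΨ)

/-- **Registered form of the end-level transfer** (sub-goal `silentTameEnd_isMinkowski_or_isKerrDoc_of_SEK` of
stmt-FinalStateConjecture-17430; statement of `isMinkowski_or_exists_isKerrDoc_of_silentEternalIsKerr` with all
binders after the colon and `Literature.Geometry.Lorentzian` names shortened). [cite: DafermosLuk2017, Conjecture 1] -/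
theorem silentTameEnd_isMinkowski_or_isKerrDoc_of_SEK : ∀ [Kerr.Facts], (∀ (M R : ℝ) (C : ℕ → ℝ), 0 ≤ M → max (2 * M) 0 < R → ∀ (𝓢 : Spacetime.{0} 4) [𝓢.metric.toPseudoRiemannianMetric.HasLeviCivita] [Kerr.Facts], 𝓢.metric.toPseudoRiemannianMetric.IsRicciFlat → 𝓢.metric.IsGloballyHyperbolic 𝓢.timeOrientation → ∀ (Φ : Kerr.region (0 : ℝ) R → 𝓢.carrier), IsLocalDiffeomorph 𝓘(ℝ, E4) (𝓡 4) (⊤ : ℕ∞) Φ → Function.Injective Φ → let B : ModelBackground := ⟨Kerr.region 0 R, Kerr.bilin M 0, fun x ↦ x 0, Kerr.radius 0⟩; let h : E4 → E4 →L[ℝ] E4 →L[ℝ] ℝ := 𝓢.deviationExtend B Φ; let hₜ : E4 → E4 →L[ℝ] E4 →L[ℝ] ℝ := fun y ↦ fderiv ℝ h y (E4.basisVector 0); (∀ (m : ℕ) (x : Kerr.region (0 : ℝ) R), ‖iteratedFDeriv ℝ m h x.1‖ * Kerr.radius 0 x.1 ≤ C m) → (∀ (m : ℕ), ∀ δ >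 (0 : ℝ), ∃ R' : ℝ, ∀ x : Kerr.region (0 : ℝ) R, R' < Kerr.radius 0 x.1 → ‖iteratedFDeriv ℝ m hₜ x.1‖ * Kerr.radius 0 x.1 ≤ δ) → ((𝓢.blackHoleRegionOfEnd (Set.range Φ)).Nonempty ∨ (𝓢.metric.IsTimelikeGeodesicallyComplete ∧ 𝓢.metric.IsNullGeodesicallyComplete)) → (∃ (M' a : ℝ), 0 < M' ∧ |a| ≤ M' ∧ ∃ Ψ : Kerr.exterior M' a → 𝓢.carrier, Function.Injective Ψ ∧ Set.range Ψ = 𝓢.docOfEnd (Set.range Φ) ∧ PseudoRiemannianMetric.IsLocalIsometry (Kerr.smoothMetric M' a (Kerr.rPlus M' a)).toPseudoRiemannianMetric 𝓢.metric.toPseudoRiemannianMetric Ψ) ∨ (∃ Ψ : Diffeomorph (𝓡 4) 𝓘(ℝ, E4) 𝓢.carrier E4 (⊤ : ℕ∞), PseudoRiemannianMetric.IsIsometry 𝓢.metric.toPseudoRiemannianMetric (Minkowski.metric.ofLE le_top : LorentzianMetric 𝓘(ℝ, E4) (⊤ : ℕ∞) E4).toPseudoRiemannianMetric Ψ)) →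 ∀ {𝓢 : Spacetime.{0} 4} [𝓢.metric.HasLeviCivita] (E : EndDatum 𝓢) {Λ : ℕ → ℝ≥0} {r₀ : ℝ}, IsTameClass E Λ r₀ → E.IsSilent → 𝓢.metric.IsGloballyHyperbolic 𝓢.timeOrientation → ((𝓢.blackHoleRegionOfEnd (Set.range E.far)).Nonempty ∨ (𝓢.metric.IsTimelikeGeodesicallyComplete ∧ 𝓢.metric.IsNullGeodesicallyComplete)) → (∀ M' a : ℝ, 0 < M' → |a| ≤ M' → (∃ Ψ : Kerr.exterior M' a → 𝓢.carrier, Function.Injective Ψ ∧ Set.range Ψ = E.doc ∧ PseudoRiemannianMetric.IsLocalIsometry (Kerr.smoothMetric M' a (Kerr.rPlus M' a)).toPseudoRiemannianMetric 𝓢.metric.toPseudoRiemannianMetric Ψ) → |a| < M') → (IsMinkowski 𝓢 ∨ ∃ M a : ℝ, 0 < M ∧ |a| < M ∧ IsKerrDoc 𝓢 E.doc M a) :=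
by
  intro _ hSEK 𝓢 _ E Λ r₀ hcls hsil hGH hbh hsub
  exact isMinkowski_or_exists_isKerrDoc_of_silentEternalIsKerr hSEK E hcls hsil hGH hbh hsub

/-! ### §3 The two hull-element forms, and R's text from SEK plus the side conditions -/

section Hull

variable {X : Type} [TopologicalSpace X] [ChartedSpace E3 X] [IsManifold (𝓡 3) ∞ X]
  [T2Space X] [SecondCountableTopology X] [ConnectedSpace X] {D : InitialDataSet (𝓡 3) X}

omit [T2Space X] [SecondCountableTopology X] in
/-- **R2-shape (horizon-hull elements).** SEK + a horizon-hull element `(𝓢, E, p)` along `γ ∘ s` which is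
globally hyperbolic (G2), non-extremal up to orientation (G5) and not Minkowski (G6; e.g. by the landed
Kretschmann pinning `DarkFuture.not_isMinkowski_of_isHorizonHullElement_of_le`) ⇒ its d.o.c. is EXACTLY a
sub-extremal Kerr exterior. The black-hole disjunct of SEK is automatic: `p ∈ E.horizon` lies in the black-hole
region of the end (`blackHoleRegion_nonempty_of_isHorizonHullElementAlong`, G3). [cite: DafermosLuk2017, Conjecture 1] -/
theorem exists_isKerrDoc_of_isHorizonHullElementAlong_of_SEK [Kerr.Facts]
    (hSEK : ∀ (M R : ℝ) (C : ℕ → ℝ), 0 ≤ M → max (2 * M) 0 < R → ∀ (𝓢 : Literature.Geometry.Lorentzian.Spacetime.{0} 4) [𝓢.metric.toPseudoRiemannianMetric.HasLeviCivita] [Literature.Geometry.Lorentzian.Kerr.Facts], 𝓢.metric.toPseudoRiemannianMetric.IsRicciFlat → 𝓢.metric.IsGloballyHyperbolic 𝓢.timeOrientation → ∀ (Φ : Literature.Geometry.Lorentzian.Kerr.region (0 : ℝ) R → 𝓢.carrier), IsLocalDiffeomorph 𝓘(ℝ, Literature.Geometry.Lorentzian.E4) (𝓡 4) (⊤ : ℕ∞)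 Φ → Function.Injective Φ → let B : Literature.Geometry.Lorentzian.ModelBackground := ⟨Literature.Geometry.Lorentzian.Kerr.region 0 R, Literature.Geometry.Lorentzian.Kerr.bilin M 0, fun x ↦ x 0, Literature.Geometry.Lorentzian.Kerr.radius 0⟩; let h : Literature.Geometry.Lorentzian.E4 → Literature.Geometry.Lorentzian.E4 →L[ℝ] Literature.Geometry.Lorentzian.E4 →L[ℝ] ℝ := 𝓢.deviationExtend B Φ; let hₜ : Literature.Geometry.Lorentzian.E4 → Literature.Geometry.Lorentzian.E4 →L[ℝ] Literature.Geometry.Lorentzian.E4 →L[ℝ] ℝ := fun y ↦ fderiv ℝ h y (Literature.Geometry.Lorentzian.E4.basisVector 0); (∀ (m : ℕ) (x : Literature.Geometry.Lorentzian.Kerr.region (0 : ℝ) R), ‖iteratedFDeriv ℝ m h x.1‖ * Literature.Geometry.Lorentzian.Kerr.radius 0 x.1 ≤ C m) → (∀ (m : ℕ), ∀ δ > (0 : ℝ), ∃ R' : ℝ, ∀ x : Literature.Geometry.Lorentzian.Kerr.region (0 : ℝ) R, R' < Literature.Geometry.Lorentzian.Kerr.radius 0 x.1 → ‖iteratedFDeriv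 ℝ m hₜ x.1‖ * Literature.Geometry.Lorentzian.Kerr.radius 0 x.1 ≤ δ) → ((𝓢.blackHoleRegionOfEnd (Set.range Φ)).Nonempty ∨ (𝓢.metric.IsTimelikeGeodesicallyComplete ∧ 𝓢.metric.IsNullGeodesicallyComplete)) → (∃ (M' a : ℝ), 0 < M' ∧ |a| ≤ M' ∧ ∃ Ψ : Literature.Geometry.Lorentzian.Kerr.exterior M' a → 𝓢.carrier, Function.Injective Ψ ∧ Set.range Ψ = 𝓢.docOfEnd (Set.range Φ) ∧ Literature.Geometry.Lorentzian.PseudoRiemannianMetric.IsLocalIsometry (Literature.Geometry.Lorentzian.Kerr.smoothMetric M' a (Literature.Geometry.Lorentzian.Kerr.rPlus M' a)).toPseudoRiemannianMetric 𝓢.metric.toPseudoRiemannianMetric Ψ) ∨ (∃ Ψ : Diffeomorph (𝓡 4) 𝓘(ℝ, Literature.Geometry.Lorentzian.E4) 𝓢.carrier Literature.Geometry.Lorentzian.E4 (⊤ : ℕ∞), Literature.Geometry.Lorentzian.PseudoRiemannianMetric.IsIsometry 𝓢.metric.toPseudoRiemannianMetric (Literature.Geometry.Lorentzian.Minkowski.metric.ofLE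 le_top : Literature.Geometry.Lorentzian.LorentzianMetric 𝓘(ℝ, Literature.Geometry.Lorentzian.E4) (⊤ : ℕ∞) Literature.Geometry.Lorentzian.E4).toPseudoRiemannianMetric Ψ))
    {𝒟 : VacuumCauchyDevelopment D} [𝒟.metric.HasLeviCivita] {Λ : ℕ → ℝ≥0} {r₀ : ℝ}
    {γ : ℝ → 𝒟.carrier} {s : ℕ → ℝ} {𝓢 : Spacetime.{0} 4} [𝓢.metric.HasLeviCivita] {E : EndDatum 𝓢}
    {p : 𝓢.carrier} (hZ : IsHorizonHullElementAlong 𝒟 Λ r₀ γ s 𝓢 E p)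
    (hGH : 𝓢.metric.IsGloballyHyperbolic 𝓢.timeOrientation)
    (hsub : ∀ M' a : ℝ, 0 < M' → |a| ≤ M' →
      (∃ Ψ : Kerr.exterior M' a → 𝓢.carrier, Function.Injective Ψ ∧ Set.range Ψ = E.doc ∧
        PseudoRiemannianMetric.IsLocalIsometry
          (Kerr.smoothMetric M' a (Kerr.rPlus M' a)).toPseudoRiemannianMetric
          𝓢.metric.toPseudoRiemannianMetric Ψ) → |a| < M')
    (hflat : ¬ IsMinkowski 𝓢) :
    ∃ M a : ℝ, 0 < M ∧ |a| < M ∧ IsKerrDoc 𝓢 E.doc M a := by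
  have hbh : (𝓢.blackHoleRegionOfEnd (Set.range E.far)).Nonempty :=
    blackHoleRegion_nonempty_of_isHorizonHullElementAlong hZ
  rcases isMinkowski_or_exists_isKerrDoc_of_silentEternalIsKerr hSEK E hZ.1 hZ.2.1 hGH (Or.inl hbh) hsub
    with hmink | hkerr
  · exact absurd hmink hflat
  · exact hkerr

omit [T2Space X] [SecondCountableTopology X] in
/-- **R1-shape (silent outer hull elements).** SEK + a silent outer hull element `(𝓢, E, p)` along `q` which
is globally hyperbolic (G2), non-extremal up to orientation (G5), and — ONLY IF ITS HORIZON IS EMPTY — a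
black-hole spacetime w.r.t. its end or timelike+null complete (G6: an outer element with NONEMPTY horizon is a
black-hole spacetime w.r.t. its end for free, `blackHoleRegion_nonempty_of_mem_horizon`) ⇒ `𝓢` is Minkowski
or its d.o.c. is EXACTLY a sub-extremal Kerr exterior. [cite: DafermosLuk2017, Conjecture 1] -/
theorem isMinkowski_or_exists_isKerrDoc_of_isSilentHullElement_of_SEK [Kerr.Facts]
    (hSEK : ∀ (M R : ℝ) (C : ℕ → ℝ), 0 ≤ M → max (2 * M) 0 < R → ∀ (𝓢 : Literature.Geometry.Lorentzian.Spacetime.{0} 4) [𝓢.metric.toPseudoRiemannianMetric.HasLeviCivita] [Literature.Geometry.Lorentzian.Kerr.Facts], 𝓢.metric.toPseudoRiemannianMetric.IsRicciFlat → 𝓢.metric.IsGloballyHyperbolic 𝓢.timeOrientation → ∀ (Φ : Literature.Geometry.Lorentzian.Kerr.region (0 : ℝ) R → 𝓢.carrier), IsLocalDiffeomorph 𝓘(ℝ, Literature.Geometry.Lorentzian.E4) (𝓡 4) (⊤ : ℕ∞) Φ → Function.Injective Φ → let B : Literature.Geometry.Lorentzian.ModelBackground := ⟨Literature.Geometry.Lorentzian.Kerr.region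 0 R, Literature.Geometry.Lorentzian.Kerr.bilin M 0, fun x ↦ x 0, Literature.Geometry.Lorentzian.Kerr.radius 0⟩; let h : Literature.Geometry.Lorentzian.E4 → Literature.Geometry.Lorentzian.E4 →L[ℝ] Literature.Geometry.Lorentzian.E4 →L[ℝ] ℝ := 𝓢.deviationExtend B Φ; let hₜ : Literature.Geometry.Lorentzian.E4 → Literature.Geometry.Lorentzian.E4 →L[ℝ] Literature.Geometry.Lorentzian.E4 →L[ℝ] ℝ := fun y ↦ fderiv ℝ h y (Literature.Geometry.Lorentzian.E4.basisVector 0); (∀ (m : ℕ) (x : Literature.Geometry.Lorentzian.Kerr.region (0 : ℝ) R), ‖iteratedFDeriv ℝ m h x.1‖ * Literature.Geometry.Lorentzian.Kerr.radius 0 x.1 ≤ C m) → (∀ (m : ℕ), ∀ δ > (0 : ℝ), ∃ R' : ℝ, ∀ x : Literature.Geometry.Lorentzian.Kerr.region (0 : ℝ) R, R' < Literature.Geometry.Lorentzian.Kerr.radius 0 x.1 → ‖iteratedFDeriv ℝ m hₜ x.1‖ * Literature.Geometry.Lorentzian.Kerr.radius 0 x.1 ≤ δ) → ((𝓢.blackHoleRegionOfEnd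 (Set.range Φ)).Nonempty ∨ (𝓢.metric.IsTimelikeGeodesicallyComplete ∧ 𝓢.metric.IsNullGeodesicallyComplete)) → (∃ (M' a : ℝ), 0 < M' ∧ |a| ≤ M' ∧ ∃ Ψ : Literature.Geometry.Lorentzian.Kerr.exterior M' a → 𝓢.carrier, Function.Injective Ψ ∧ Set.range Ψ = 𝓢.docOfEnd (Set.range Φ) ∧ Literature.Geometry.Lorentzian.PseudoRiemannianMetric.IsLocalIsometry (Literature.Geometry.Lorentzian.Kerr.smoothMetric M' a (Literature.Geometry.Lorentzian.Kerr.rPlus M' a)).toPseudoRiemannianMetric 𝓢.metric.toPseudoRiemannianMetric Ψ) ∨ (∃ Ψ : Diffeomorph (𝓡 4) 𝓘(ℝ, Literature.Geometry.Lorentzian.E4) 𝓢.carrier Literature.Geometry.Lorentzian.E4 (⊤ : ℕ∞), Literature.Geometry.Lorentzian.PseudoRiemannianMetric.IsIsometry 𝓢.metric.toPseudoRiemannianMetric (Literature.Geometry.Lorentzian.Minkowski.metric.ofLE le_top : Literature.Geometry.Lorentzian.LorentzianMetric 𝓘(ℝ, Literature.Geometry.Lorentzian.E4) (⊤ : ℕ∞)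 Literature.Geometry.Lorentzian.E4).toPseudoRiemannianMetric Ψ))
    {𝒟 : VacuumCauchyDevelopment D} [𝒟.metric.HasLeviCivita] {Λ : ℕ → ℝ≥0} {r₀ : ℝ}
    {q : ℕ → 𝒟.carrier} {𝓢 : Spacetime.{0} 4} [𝓢.metric.HasLeviCivita] {E : EndDatum 𝓢} {p : 𝓢.carrier}
    (hZ : IsSilentHullElement 𝒟 Λ r₀ q 𝓢 E p)
    (hGH : 𝓢.metric.IsGloballyHyperbolic 𝓢.timeOrientation)
    (hbh0 : E.horizon = ∅ → (𝓢.blackHoleRegionOfEnd (Set.range E.far)).Nonempty ∨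
      (𝓢.metric.IsTimelikeGeodesicallyComplete ∧ 𝓢.metric.IsNullGeodesicallyComplete))
    (hsub : ∀ M' a : ℝ, 0 < M' → |a| ≤ M' →
      (∃ Ψ : Kerr.exterior M' a → 𝓢.carrier, Function.Injective Ψ ∧ Set.range Ψ = E.doc ∧
        PseudoRiemannianMetric.IsLocalIsometry
          (Kerr.smoothMetric M' a (Kerr.rPlus M' a)).toPseudoRiemannianMetric
          𝓢.metric.toPseudoRiemannianMetric Ψ) → |a| < M') :
    IsMinkowski 𝓢 ∨ ∃ M a : ℝ, 0 < M ∧ |a| < M ∧ IsKerrDoc 𝓢 E.doc M a := by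
  have hbh : (𝓢.blackHoleRegionOfEnd (Set.range E.far)).Nonempty ∨
      (𝓢.metric.IsTimelikeGeodesicallyComplete ∧ 𝓢.metric.IsNullGeodesicallyComplete) := by
    rcases (E.horizon).eq_empty_or_nonempty with hempty | ⟨p', hp'⟩
    · exact hbh0 hempty
    · exact Or.inl ⟨p', blackHoleRegion_nonempty_of_mem_horizon E hp'⟩
  exact isMinkowski_or_exists_isKerrDoc_of_silentEternalIsKerr hSEK E hZ.2.1 hZ.2.2.1 hGH hbh hsub

end Hull

/-- **R's registered text from SEK and the side conditions asked of EVERY element** (the reduction of stub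
`stub_hullRigidGivenSEK` of line `tame-lasalle-dock`; R's text VERBATIM as the conclusion, SEK verbatim as its
antecedent). The residual hypothesis `hside` is what R still owes: for every silent outer hull element and every
horizon-hull element of a development as in Φ — (G2) global hyperbolicity, (G5) sub-extremality of every Kerr
exterior isometric to the d.o.c. up to orientation, (G6) horizonless outer elements are black-hole-or-complete
and horizon-hull elements are not Minkowski. (G2) is FALSE for elements trimmed inside their black-hole region
(no covering clause), so the honest form of `hside` is "after passing to a globally hyperbolic representative with
the same d.o.c." (transfer: `DarkFuture.isKerrDoc_of_isLocalIsometry_image`); this theorem records the logic,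
not that repair. [cite: DafermosLuk2017, Conjecture 1] -/
theorem hullRigidGivenSEK_of_sideConditions :
    (∀ (X : Type) [TopologicalSpace X] [ChartedSpace E3 X] [IsManifold (𝓡 3) ∞ X] [T2Space X]
      [SecondCountableTopology X] [ConnectedSpace X], ∀ D ∈ admissibleVacuumData X,
      ∀ (𝒟 : VacuumCauchyDevelopment D) [𝒟.metric.HasLeviCivita], DevHyp 𝒟 →
        ∀ (Λ : ℕ → ℝ≥0) (r₀ : ℝ) (𝓢 : Spacetime.{0} 4) (E : EndDatum 𝓢) (p : 𝓢.carrier), ∀ [Kerr.Facts],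
          ((∃ q : ℕ → 𝒟.carrier, IsSilentHullElement 𝒟 Λ r₀ q 𝓢 E p) ∨
            (∃ (γ : ℝ → 𝒟.carrier) (s : ℕ → ℝ), IsHorizonPath 𝒟 γ ∧ Tendsto s atTop atTop ∧
              IsHorizonHullElementAlong 𝒟 Λ r₀ γ s 𝓢 E p)) →
          𝓢.metric.IsGloballyHyperbolic 𝓢.timeOrientation ∧
          (∀ M' a : ℝ, 0 < M' → |a| ≤ M' →
            (∃ Ψ : Kerr.exterior M' a → 𝓢.carrier, Function.Injective Ψ ∧ Set.range Ψ = E.doc ∧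
              PseudoRiemannianMetric.IsLocalIsometry
                (Kerr.smoothMetric M' a (Kerr.rPlus M' a)).toPseudoRiemannianMetric
                𝓢.metric.toPseudoRiemannianMetric Ψ) → |a| < M') ∧
          (∀ [𝓢.metric.HasLeviCivita], E.horizon = ∅ →
            (𝓢.blackHoleRegionOfEnd (Set.range E.far)).Nonempty ∨
              (𝓢.metric.IsTimelikeGeodesicallyComplete ∧ 𝓢.metric.IsNullGeodesicallyComplete)) ∧
          (p ∈ E.horizon → ¬ IsMinkowski 𝓢)) →
    (∀ (M R : ℝ) (C : ℕ → ℝ), 0 ≤ M → max (2 * M) 0 < R → ∀ (𝓢 : Literature.Geometry.Lorentzian.Spacetime.{0} 4) [𝓢.metric.toPseudoRiemannianMetric.HasLeviCivita] [Literature.Geometry.Lorentzian.Kerr.Facts], 𝓢.metric.toPseudoRiemannianMetric.IsRicciFlat → 𝓢.metric.IsGloballyHyperbolic 𝓢.timeOrientation → ∀ (Φ : Literature.Geometry.Lorentzian.Kerr.region (0 : ℝ) R → 𝓢.carrier), IsLocalDiffeomorph 𝓘(ℝ, Literature.Geometry.Lorentzian.E4) (𝓡 4) (⊤ : ℕ∞)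 Φ → Function.Injective Φ → let B : Literature.Geometry.Lorentzian.ModelBackground := ⟨Literature.Geometry.Lorentzian.Kerr.region 0 R, Literature.Geometry.Lorentzian.Kerr.bilin M 0, fun x ↦ x 0, Literature.Geometry.Lorentzian.Kerr.radius 0⟩; let h : Literature.Geometry.Lorentzian.E4 → Literature.Geometry.Lorentzian.E4 →L[ℝ] Literature.Geometry.Lorentzian.E4 →L[ℝ] ℝ := 𝓢.deviationExtend B Φ; let hₜ : Literature.Geometry.Lorentzian.E4 → Literature.Geometry.Lorentzian.E4 →L[ℝ] Literature.Geometry.Lorentzian.E4 →L[ℝ] ℝ := fun y ↦ fderiv ℝ h y (Literature.Geometry.Lorentzian.E4.basisVector 0); (∀ (m : ℕ) (x : Literature.Geometry.Lorentzian.Kerr.region (0 : ℝ) R), ‖iteratedFDeriv ℝ m h x.1‖ * Literature.Geometry.Lorentzian.Kerr.radius 0 x.1 ≤ C m) → (∀ (m : ℕ), ∀ δ > (0 : ℝ), ∃ R' : ℝ, ∀ x : Literature.Geometry.Lorentzian.Kerr.region (0 : ℝ) R, R' < Literature.Geometry.Lorentzian.Kerr.radius 0 x.1 → ‖iteratedFDeriv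 ℝ m hₜ x.1‖ * Literature.Geometry.Lorentzian.Kerr.radius 0 x.1 ≤ δ) → ((𝓢.blackHoleRegionOfEnd (Set.range Φ)).Nonempty ∨ (𝓢.metric.IsTimelikeGeodesicallyComplete ∧ 𝓢.metric.IsNullGeodesicallyComplete)) → (∃ (M' a : ℝ), 0 < M' ∧ |a| ≤ M' ∧ ∃ Ψ : Literature.Geometry.Lorentzian.Kerr.exterior M' a → 𝓢.carrier, Function.Injective Ψ ∧ Set.range Ψ = 𝓢.docOfEnd (Set.range Φ) ∧ Literature.Geometry.Lorentzian.PseudoRiemannianMetric.IsLocalIsometry (Literature.Geometry.Lorentzian.Kerr.smoothMetric M' a (Literature.Geometry.Lorentzian.Kerr.rPlus M' a)).toPseudoRiemannianMetric 𝓢.metric.toPseudoRiemannianMetric Ψ) ∨ (∃ Ψ : Diffeomorph (𝓡 4) 𝓘(ℝ, Literature.Geometry.Lorentzian.E4) 𝓢.carrier Literature.Geometry.Lorentzian.E4 (⊤ : ℕ∞), Literature.Geometry.Lorentzian.PseudoRiemannianMetric.IsIsometry 𝓢.metric.toPseudoRiemannianMetric (Literature.Geometry.Lorentzian.Minkowski.metric.ofLE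 le_top : Literature.Geometry.Lorentzian.LorentzianMetric 𝓘(ℝ, Literature.Geometry.Lorentzian.E4) (⊤ : ℕ∞) Literature.Geometry.Lorentzian.E4).toPseudoRiemannianMetric Ψ)) →
      (∀ (X : Type) [TopologicalSpace X] [ChartedSpace E3 X] [IsManifold (𝓡 3) ∞ X] [T2Space X]
        [SecondCountableTopology X] [ConnectedSpace X], ∀ D ∈ admissibleVacuumData X,
        ∀ (𝒟 : VacuumCauchyDevelopment D) [𝒟.metric.HasLeviCivita], DevHyp 𝒟 →
          ∀ (Λ : ℕ → ℝ≥0) (r₀ : ℝ) (q : ℕ → 𝒟.carrier) (𝓢 : Spacetime.{0} 4) (E : EndDatum 𝓢)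
            (p : 𝓢.carrier), IsSilentHullElement 𝒟 Λ r₀ q 𝓢 E p →
            IsMinkowski 𝓢 ∨ ∃ M a : ℝ, 0 < M ∧ |a| < M ∧ IsKerrDoc 𝓢 E.doc M a) ∧
      (∀ (X : Type) [TopologicalSpace X] [ChartedSpace E3 X] [IsManifold (𝓡 3) ∞ X] [T2Space X]
        [SecondCountableTopology X] [ConnectedSpace X], ∀ D ∈ admissibleVacuumData X,
        ∀ (𝒟 : VacuumCauchyDevelopment D) [𝒟.metric.HasLeviCivita], DevHyp 𝒟 →
          ∀ (Λ : ℕ → ℝ≥0) (r₀ : ℝ) (γ : ℝ → 𝒟.carrier), IsHorizonPath 𝒟 γ →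
            ∀ (𝓢 : Spacetime.{0} 4) (E : EndDatum 𝓢) (p : 𝓢.carrier),
              IsHorizonHullElement 𝒟 Λ r₀ γ 𝓢 E p → ∃ M a : ℝ, 0 < M ∧ |a| < M ∧ IsKerrDoc 𝓢 E.doc M a) := by
  intro hside hSEK
  -- the Kerr chart facts are theorems of the tree (cf. `Theorems.SwallowTheDatum.kerrFacts`)
  haveI : Kerr.Facts :=
    ⟨Kerr.isConnected_region_holds, Kerr.contMDiff_bilin_holds, Kerr.contMDiff_timeVector_holds⟩
  refine ⟨?_, ?_⟩
  · intro X _ _ _ _ _ _ D hD 𝒟 _ hdev Λ r₀ q 𝓢 E p hZ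
    haveI : 𝓢.metric.HasLeviCivita := 𝓢.metric.toPseudoRiemannianMetric.hasLeviCivita
    obtain ⟨hGH, hsub, hbh0, -⟩ := hside X D hD 𝒟 hdev Λ r₀ 𝓢 E p (Or.inl ⟨q, hZ⟩)
    exact isMinkowski_or_exists_isKerrDoc_of_isSilentHullElement_of_SEK hSEK hZ hGH hbh0 hsub
  · intro X _ _ _ _ _ _ D hD 𝒟 _ hdev Λ r₀ γ hγ 𝓢 E p hZ
    haveI : 𝓢.metric.HasLeviCivita := 𝓢.metric.toPseudoRiemannianMetric.hasLeviCivita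
    obtain ⟨s, hs, hZs⟩ := hZ
    obtain ⟨hGH, hsub, -, hflat⟩ := hside X D hD 𝒟 hdev Λ r₀ 𝓢 E p (Or.inr ⟨γ, s, hγ, hs, hZs⟩)
    exact exists_isKerrDoc_of_isHorizonHullElementAlong_of_SEK hSEK hZs hGH hsub (hflat hZs.2.2.1)

end Summit.FinalStateConjecture.FinalStateConjecture.Theorems.TameLaSalle

end
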